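import Summits.Ventures.HSemireg.DividedSquareParity

/-!
# Coefficient functionals of a basis 4-subset and the support of a leading digit (pub-hsemireg, S4-PUSH corner 2)

Kernel leg of seat s4-search-2 gen 17 (cell `pub-hsemireg`), ROW S; companion of `DividedSquareParity.lean` (ROW P)
for the `E ≠ ∅` units, where CRITERION L at `k = 2` says `B·B ≡ 2·Ω (mod 4Λ)` for a NON-ZERO 4-form `Ω` (for the
(2,2,3,3,3,3) edge unit `Ω = h₀h₁ = x₀x₁x₂x₃`) instead of `B·B ∈ 4Λ`.

**Contents.**  `M` free with a basis `x : n → M` (`n` a finite linear order).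
1. `exists_coeffFunctional` — for four pairwise distinct indices `i, j, k, l` a `ℤ`-linear functional `Φ` on
   `ExteriorAlgebra ℤ M` (top coefficient of `Λ(ℤ⁴)` after the coordinate projection onto `x_i, …, x_l`, as in ROW P)
   with `Φ(ι x_i ι x_j · ι x_k ι x_l) = 1`, `Φ(Y · ι x_a · Y') = 0` for `a ∉ {i, j, k, l}`, `Φ(m·Y) = m·Φ(Y)`, and
   `Φ(B·B) = 2·Pf_{ijkl}(c)` for every 2-form `B = Σ_{a<b} c a b · ι x_a ι x_b` with `c` alternating
   (`DividedSquareLemma.sq_eq_two_mul_pfaffian_smul`).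
2. `pfaffian_odd_of_sq` ∕ `pfaffian_even_of_sq_outside` — if `B·B = 2·(ι x_{m₀} ι x_{m₁} · ι x_{m₂} ι x_{m₃}) + 4W` then
   `Pf_{m₀m₁m₂m₃}(c)` is ODD and every Pfaffian whose index quadruple misses one of `m₀, …, m₃` is EVEN.
3. `entry_eq_zero_of_pfaffians` ∕ `support_of_pfaffians` — over a field, a skew array whose Pfaffian on
   `m₀, m₁, m₂, m₃` is non-zero and whose Pfaffians missing one of the `m_r` vanish is supported on `{m₀, …, m₃}`
   (four three-term syzygies `A m₀m₁·Pf(a,m₀,m₂,m₃) − A m₀m₂·Pf(a,m₀,m₁,m₃) + A m₀m₃·Pf(a,m₀,m₁,m₂) = A a m₀·Pf`, then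
   `Pf(a,b,m_r,m_s) = A a b·A m_r m_s`).
The edge unit's leading-digit identification itself is `EdgeLeadingDigit.lean` (ROW T); its composition with ROW J
is `EdgeUnitEveryDigit.lean` (ROW U).

Scope ∕ honest framing: multilinear ∕ linear algebra over `ℤ` and `𝔽₂` (count-neutral, theorems only, no `def`);
CRITERION L as the registered necessary condition, the signature table and the census remain framework words of
`s4push/search-2/`; no object, no `σ` computation, no Hodge statement; nothing here bears on HC ∕ HC_CM ∕ HC_AV.
-/

namespace Summit.Ventures.HSemireg.EdgeDigitSupport

open ExteriorAlgebra DecomposableTwoForms DividedSquareParity TwoAdicReadings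

section Functional

variable {M : Type*} [AddCommGroup M] [Module ℤ M] {n : Type*} [LinearOrder n] [Fintype n]

/-- **The coefficient functional of a basis 4-subset.**  For a basis `x` and four pairwise distinct indices
`i, j, k, l` there is a `ℤ`-linear functional `Φ` on `ExteriorAlgebra ℤ M` (top coefficient of `Λ(ℤ⁴)` after the
coordinate projection onto `x_i, x_j, x_k, x_l`) with: `Φ(ι x_i ι x_j · ι x_k ι x_l) = 1`; `Φ` kills every product
through a generator `ι x_a` with `a ∉ {i, j, k, l}`; `Φ(n·Y) = n·Φ(Y)`; and for every alternating integer array `c`,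
`Φ(B·B) = 2·Pf_{ijkl}(c)` for the 2-form `B = Σ_{a<b} c a b · ι x_a ι x_b`. -/
theorem exists_coeffFunctional (x : Module.Basis n ℤ M) {i j k l : n} (hij : i ≠ j) (hik : i ≠ k) (hil : i ≠ l)
    (hjk : j ≠ k) (hjl : j ≠ l) (hkl : k ≠ l) :
    ∃ Φ : ExteriorAlgebra ℤ M →ₗ[ℤ] ℤ,
      Φ (ι ℤ (x i) * ι ℤ (x j) * (ι ℤ (x k) * ι ℤ (x l))) = 1 ∧
      (∀ a, a ≠ i → a ≠ j → a ≠ k → a ≠ l → ∀ Y Y' : ExteriorAlgebra ℤ M, Φ (Y * ι ℤ (x a) * Y') = 0) ∧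
      (∀ (m : ℕ) [m.AtLeastTwo] (Y : ExteriorAlgebra ℤ M), Φ (OfNat.ofNat m * Y) = OfNat.ofNat m * Φ Y) ∧
      (∀ c : n → n → ℤ, (∀ a, c a a = 0) → (∀ a b, c b a = -c a b) →
        Φ ((∑ a, ∑ b, if a < b then (c a b : ExteriorAlgebra ℤ M) * (ι ℤ (x a) * ι ℤ (x b)) else 0)
            * (∑ a, ∑ b, if a < b then (c a b : ExteriorAlgebra ℤ M) * (ι ℤ (x a) * ι ℤ (x b)) else 0))
          = 2 * (c i j * c k l - c i k * c j l + c i l * c j k)) := by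
  set f : Fin 4 → n := ![i, j, k, l] with hf
  have hinj : Function.Injective f := injective_vecFour hij hik hil hjk hjl hkl
  set π : M →ₗ[ℤ] (Fin 4 → ℤ) := LinearMap.pi fun r => x.coord (f r) with hπdef
  set e : Fin 4 → (Fin 4 → ℤ) := fun r => Pi.single r 1 with he
  have hπ : ∀ a, π (x a) = fun r => if a = f r then (1 : ℤ) else 0 := by
    intro a; funext r
    simp [hπdef, Finsupp.single_apply]
  have hπ0 : ∀ a, (∀ r, a ≠ f r) → π (x a) = 0 := by
    intro a ha; rw [hπ]; funext r; simp [ha r]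
  have hπf : ∀ r, π (x (f r)) = e r := by
    intro r; rw [hπ]; funext s
    simp [he, Pi.single_apply, hinj.eq_iff, eq_comm]
  obtain ⟨τ, hτ⟩ := exists_topCoeff ℤ 4
  have htop : ι ℤ (e 0) * ι ℤ (e 1) * (ι ℤ (e 2) * ι ℤ (e 3)) = ιMulti ℤ 4 e := by
    rw [ιMulti_apply]; simp [List.ofFn_succ, he, mul_assoc]
  refine ⟨τ ∘ₗ (ExteriorAlgebra.map π).toLinearMap, ?_, ?_, ?_, ?_⟩
  · -- the value `1` on `x_i x_j x_k x_l`
    have h0 : f 0 = i := by simp [hf]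
    have h1 : f 1 = j := by simp [hf]
    have h2 : f 2 = k := by simp [hf]
    have h3 : f 3 = l := by simp [hf]
    have p0 : π (x i) = e 0 := by have h := hπf 0; rwa [h0] at h
    have p1 : π (x j) = e 1 := by have h := hπf 1; rwa [h1] at h
    have p2 : π (x k) = e 2 := by have h := hπf 2; rwa [h2] at h
    have p3 : π (x l) = e 3 := by have h := hπf 3; rwa [h3] at h
    have hm : ExteriorAlgebra.map π (ι ℤ (x i) * ι ℤ (x j) * (ι ℤ (x k) * ι ℤ (x l)))
        = ι ℤ (e 0) * ι ℤ (e 1) * (ι ℤ (e 2) * ι ℤ (e 3)) := by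
      simp only [map_mul, map_apply_ι, p0, p1, p2, p3]
    show τ (ExteriorAlgebra.map π (ι ℤ (x i) * ι ℤ (x j) * (ι ℤ (x k) * ι ℤ (x l)))) = 1
    rw [hm, htop, hτ]
  · -- generators outside `{i, j, k, l}` die
    intro a hai haj hak hal Y Y'
    have ha : ∀ r, a ≠ f r := by
      intro r
      fin_cases r
      · simpa [hf] using hai
      · simpa [hf] using haj
      · simpa [hf] using hak
      · simpa [hf] using hal
    have hm : ExteriorAlgebra.map π (Y * ι ℤ (x a) * Y') = 0 := by
      simp only [map_mul, map_apply_ι, hπ0 a ha, map_zero, mul_zero, zero_mul]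
    show τ (ExteriorAlgebra.map π (Y * ι ℤ (x a) * Y')) = 0
    rw [hm, map_zero]
  · -- numerals
    intro m _ Y
    have hm : ExteriorAlgebra.map π (OfNat.ofNat m * Y) = OfNat.ofNat m * ExteriorAlgebra.map π Y := by
      simp only [map_mul, map_ofNat]
    show τ (ExteriorAlgebra.map π (OfNat.ofNat m * Y)) = OfNat.ofNat m * τ (ExteriorAlgebra.map π Y)
    rw [hm]
    exact apply_ofNat_mul τ m _
  · -- `Φ(B·B) = 2·Pf`
    intro c h0 hskew
    set Λ₄ := ExteriorAlgebra ℤ (Fin 4 → ℤ)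
    set B := ∑ a, ∑ b, if a < b then (c a b : ExteriorAlgebra ℤ M) * (ι ℤ (x a) * ι ℤ (x b)) else 0 with hB
    set g : n → n → Λ₄ := fun a b =>
      if a < b then (c a b : Λ₄) * (ι ℤ (π (x a)) * ι ℤ (π (x b))) else 0 with hg
    have hmap : ExteriorAlgebra.map π B = ∑ a, ∑ b, g a b := by
      rw [hB, map_sum]
      refine Finset.sum_congr rfl fun a _ => ?_
      rw [map_sum]
      refine Finset.sum_congr rfl fun b _ => ?_
      simp only [hg]
      split_ifs
      · rw [map_mul, map_intCast, map_mul, map_apply_ι, map_apply_ι]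
      · rw [map_zero]
    have hga : ∀ a, (∀ r, a ≠ f r) → ∀ b, g a b = 0 := by
      intro a ha b; simp only [hg, hπ0 a ha, map_zero, zero_mul, mul_zero, ite_self]
    have hgb : ∀ b, (∀ r, b ≠ f r) → ∀ a, g a b = 0 := by
      intro b hb a; simp only [hg, hπ0 b hb, map_zero, mul_zero, ite_self]
    set S : Finset n := Finset.univ.image f with hS
    have hnS : ∀ a, a ∉ S → ∀ r, a ≠ f r := by
      intro a ha r har
      exact ha (Finset.mem_image.mpr ⟨r, Finset.mem_univ _, har.symm⟩)
    have h1 : ∑ a, ∑ b, g a b = ∑ a ∈ S, ∑ b ∈ S, g a b := by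
      rw [← Finset.sum_subset (Finset.subset_univ S)
        (fun a _ ha => Finset.sum_eq_zero fun b _ => hga a (hnS a ha) b)]
      refine Finset.sum_congr rfl fun a _ => ?_
      exact (Finset.sum_subset (Finset.subset_univ S) fun b _ hb => hgb b (hnS b hb) a).symm
    have h2 : ∑ a ∈ S, ∑ b ∈ S, g a b = ∑ r, ∑ s, g (f r) (f s) := by
      rw [hS, Finset.sum_image fun r _ s _ h => hinj h]
      refine Finset.sum_congr rfl fun r _ => ?_
      rw [Finset.sum_image fun r _ s _ h => hinj h]
    have h3 : ∑ r, ∑ s, g (f r) (f s)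
        = ∑ r, ∑ s, if r < s then (c (f r) (f s) : Λ₄) * (ι ℤ (e r) * ι ℤ (e s)) else 0 := by
      simp only [hg, hπf]
      rw [sum_sum_eq_upper_add_diag (fun r s =>
        if f r < f s then (c (f r) (f s) : Λ₄) * (ι ℤ (e r) * ι ℤ (e s)) else 0)]
      simp only [lt_self_iff_false, if_false, Finset.sum_const_zero, add_zero]
      refine Finset.sum_congr rfl fun r _ => Finset.sum_congr rfl fun s _ => ?_
      by_cases hrs : r < s
      · simp only [hrs, if_true]
        rcases lt_trichotomy (f r) (f s) with h | h | h
        · simp [h, not_lt.mpr h.le]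
        · exact absurd (hinj h) hrs.ne
        · simp only [h, not_lt.mpr h.le, if_true, if_false, zero_add]
          rw [hskew (f r) (f s), Int.cast_neg, ι_mul_ι_swap (e r) (e s), neg_mul_neg]
      · simp only [hrs, if_false]
    have h4 : (∑ r, ∑ s, if r < s then (c (f r) (f s) : Λ₄) * (ι ℤ (e r) * ι ℤ (e s)) else 0)
        = (c i j : Λ₄) * (ι ℤ (e 0) * ι ℤ (e 1)) + (c i k : Λ₄) * (ι ℤ (e 0) * ι ℤ (e 2))
          + (c i l : Λ₄) * (ι ℤ (e 0) * ι ℤ (e 3)) + (c j k : Λ₄) * (ι ℤ (e 1) * ι ℤ (e 2))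
          + (c j l : Λ₄) * (ι ℤ (e 1) * ι ℤ (e 3)) + (c k l : Λ₄) * (ι ℤ (e 2) * ι ℤ (e 3)) := by
      simp only [Fin.sum_univ_four, hf]
      simp [Fin.lt_def]
      abel
    have hsq := DividedSquareLemma.sq_eq_two_mul_pfaffian_smul (R := ℤ) (e 0) (e 1) (e 2) (e 3)
      (c i j) (c i k) (c i l) (c j k) (c j l) (c k l)
    simp only [Algebra.smul_def, eq_intCast] at hsq
    rw [← h4, ← h3, ← h2, ← h1, ← hmap, sq, ← map_mul] at hsq
    show τ (ExteriorAlgebra.map π (B * B)) = _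
    rw [hsq, htop, apply_intCast_mul, hτ, mul_one]

/-- **Parity of the Pfaffians when `B·B ≡ 2·(x_i x_j x_k x_l) (mod 4)`, inside.**  If
`B·B = 2·(ι x_i ι x_j · ι x_k ι x_l) + 4W` then `Pf_{ijkl}(c)` is ODD. -/
theorem pfaffian_odd_of_sq (x : Module.Basis n ℤ M) (c : n → n → ℤ) (h0 : ∀ a, c a a = 0)
    (hskew : ∀ a b, c b a = -c a b) (B W : ExteriorAlgebra ℤ M)
    (hB : B = ∑ a, ∑ b, if a < b then (c a b : ExteriorAlgebra ℤ M) * (ι ℤ (x a) * ι ℤ (x b)) else 0)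
    {i j k l : n} (hij : i ≠ j) (hik : i ≠ k) (hil : i ≠ l) (hjk : j ≠ k) (hjl : j ≠ l) (hkl : k ≠ l)
    (hBB : B * B = 2 * (ι ℤ (x i) * ι ℤ (x j) * (ι ℤ (x k) * ι ℤ (x l))) + 4 * W) :
    ¬ (2 : ℤ) ∣ c i j * c k l - c i k * c j l + c i l * c j k := by
  obtain ⟨Φ, h1, -, hnum, hsq⟩ := exists_coeffFunctional x hij hik hil hjk hjl hkl
  have key := hsq c h0 hskew
  rw [← hB, hBB, map_add, hnum 2, hnum 4, h1] at key
  have k' : (2 : ℤ) * 1 + 4 * Φ W = 2 * (c i j * c k l - c i k * c j l + c i l * c j k) := key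
  rintro ⟨q, hq⟩
  omega

/-- **Parity of the Pfaffians when `B·B ≡ 2·(x_{m₀} x_{m₁} x_{m₂} x_{m₃}) (mod 4)`, outside.**  If
`B·B = 2·(ι x_{m₀} ι x_{m₁} · ι x_{m₂} ι x_{m₃}) + 4W` and one of `m₀, …, m₃` is NOT among `i, j, k, l`, then
`Pf_{ijkl}(c)` is EVEN. -/
theorem pfaffian_even_of_sq_outside (x : Module.Basis n ℤ M) (c : n → n → ℤ) (h0 : ∀ a, c a a = 0)
    (hskew : ∀ a b, c b a = -c a b) (B W : ExteriorAlgebra ℤ M)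
    (hB : B = ∑ a, ∑ b, if a < b then (c a b : ExteriorAlgebra ℤ M) * (ι ℤ (x a) * ι ℤ (x b)) else 0)
    (m₀ m₁ m₂ m₃ : n) (hBB : B * B = 2 * (ι ℤ (x m₀) * ι ℤ (x m₁) * (ι ℤ (x m₂) * ι ℤ (x m₃))) + 4 * W)
    (i j k l : n) (hout : ∃ a ∈ [m₀, m₁, m₂, m₃], a ≠ i ∧ a ≠ j ∧ a ≠ k ∧ a ≠ l) :
    (2 : ℤ) ∣ c i j * c k l - c i k * c j l + c i l * c j k := by
  -- coincident indices: the Pfaffian vanishes identically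
  by_cases hij : i = j
  · subst hij; exact ⟨0, by rw [h0 i]; ring⟩
  by_cases hik : i = k
  · subst hik; exact ⟨0, by rw [h0 i, hskew i j]; ring⟩
  by_cases hil : i = l
  · subst hil; exact ⟨0, by rw [h0 i, hskew i k, hskew i j]; ring⟩
  by_cases hjk : j = k
  · subst hjk; exact ⟨0, by rw [h0 j]; ring⟩
  by_cases hjl : j = l
  · subst hjl; exact ⟨0, by rw [h0 j, hskew j k]; ring⟩
  by_cases hkl : k = l
  · subst hkl; exact ⟨0, by rw [h0 k]; ring⟩
  obtain ⟨Φ, -, hkill, hnum, hsq⟩ := exists_coeffFunctional x hij hik hil hjk hjl hkl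
  obtain ⟨a, hmem, hai, haj, hak, hal⟩ := hout
  have hz : Φ (ι ℤ (x m₀) * ι ℤ (x m₁) * (ι ℤ (x m₂) * ι ℤ (x m₃))) = 0 := by
    simp only [List.mem_cons, List.mem_nil_iff, or_false] at hmem
    rcases hmem with rfl | rfl | rfl | rfl
    · simpa [mul_assoc] using hkill a hai haj hak hal 1 (ι ℤ (x m₁) * (ι ℤ (x m₂) * ι ℤ (x m₃)))
    · simpa [mul_assoc] using hkill a hai haj hak hal (ι ℤ (x m₀)) (ι ℤ (x m₂) * ι ℤ (x m₃))
    · simpa [mul_assoc] using hkill a hai haj hak hal (ι ℤ (x m₀) * ι ℤ (x m₁)) (ι ℤ (x m₃))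
    · simpa [mul_assoc] using hkill a hai haj hak hal (ι ℤ (x m₀) * ι ℤ (x m₁) * ι ℤ (x m₂)) 1
  have key := hsq c h0 hskew
  rw [← hB, hBB, map_add, hnum 2, hnum 4, hz] at key
  have k' : (2 : ℤ) * 0 + 4 * Φ W = 2 * (c i j * c k l - c i k * c j l + c i l * c j k) := key
  exact ⟨Φ W, by omega⟩

end Functional

section Support

variable {K : Type*} [Field K] {n : Type*}

/-- One entry: if `Pf(m₀,m₁,m₂,m₃) ≠ 0` and the three Pfaffians `Pf(a,m₀,m₂,m₃)`, `Pf(a,m₀,m₁,m₃)`, `Pf(a,m₀,m₁,m₂)`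
vanish, then `A a m₀ = 0` (the combination `A m₀m₁·Pf(a,m₀,m₂,m₃) − A m₀m₂·Pf(a,m₀,m₁,m₃) + A m₀m₃·Pf(a,m₀,m₁,m₂)`
equals `A a m₀ · Pf(m₀,m₁,m₂,m₃)` identically). -/
theorem entry_eq_zero_of_pfaffians (A : n → n → K) (a m₀ m₁ m₂ m₃ : n)
    (hp : A m₀ m₁ * A m₂ m₃ - A m₀ m₂ * A m₁ m₃ + A m₀ m₃ * A m₁ m₂ ≠ 0)
    (h₁ : A a m₀ * A m₂ m₃ - A a m₂ * A m₀ m₃ + A a m₃ * A m₀ m₂ = 0)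
    (h₂ : A a m₀ * A m₁ m₃ - A a m₁ * A m₀ m₃ + A a m₃ * A m₀ m₁ = 0)
    (h₃ : A a m₀ * A m₁ m₂ - A a m₁ * A m₀ m₂ + A a m₂ * A m₀ m₁ = 0) : A a m₀ = 0 := by
  have key : A a m₀ * (A m₀ m₁ * A m₂ m₃ - A m₀ m₂ * A m₁ m₃ + A m₀ m₃ * A m₁ m₂)
      = A m₀ m₁ * (A a m₀ * A m₂ m₃ - A a m₂ * A m₀ m₃ + A a m₃ * A m₀ m₂)
        - A m₀ m₂ * (A a m₀ * A m₁ m₃ - A a m₁ * A m₀ m₃ + A a m₃ * A m₀ m₁)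
        + A m₀ m₃ * (A a m₀ * A m₁ m₂ - A a m₁ * A m₀ m₂ + A a m₂ * A m₀ m₁) := by ring
  rw [h₁, h₂, h₃, mul_zero, mul_zero, mul_zero, sub_zero, add_zero] at key
  exact (mul_eq_zero.mp key).resolve_right hp

/-- **Support of a 2-form with a decomposable non-zero divided square.**  Over a field, for a skew array `A`
(`A j i = −A i j`): if the Pfaffian on `m₀, m₁, m₂, m₃` (pairwise distinct) is non-zero and every Pfaffian whose
index quadruple misses one of `m₀, …, m₃` vanishes, then `A a b = 0` whenever `a ∉ {m₀, m₁, m₂, m₃}` — the 2-form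
lives on the four coordinates `m₀, …, m₃`. -/
theorem support_of_pfaffians (A : n → n → K) (hskew : ∀ i j, A j i = -A i j) (m₀ m₁ m₂ m₃ : n) (h01 : m₀ ≠ m₁)
    (h02 : m₀ ≠ m₂) (h03 : m₀ ≠ m₃) (h12 : m₁ ≠ m₂) (h13 : m₁ ≠ m₃) (h23 : m₂ ≠ m₃)
    (hp : A m₀ m₁ * A m₂ m₃ - A m₀ m₂ * A m₁ m₃ + A m₀ m₃ * A m₁ m₂ ≠ 0)
    (hout : ∀ i j k l : n, (∃ a ∈ [m₀, m₁, m₂, m₃], a ≠ i ∧ a ≠ j ∧ a ≠ k ∧ a ≠ l) →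
      A i j * A k l - A i k * A j l + A i l * A j k = 0)
    (a b : n) (ha₀ : a ≠ m₀) (ha₁ : a ≠ m₁) (ha₂ : a ≠ m₂) (ha₃ : a ≠ m₃) : A a b = 0 := by
  have e₀ : m₀ ∈ [m₀, m₁, m₂, m₃] := by simp
  have e₁ : m₁ ∈ [m₀, m₁, m₂, m₃] := by simp
  have e₂ : m₂ ∈ [m₀, m₁, m₂, m₃] := by simp
  have e₃ : m₃ ∈ [m₀, m₁, m₂, m₃] := by simp
  have hp1 : A m₁ m₀ * A m₂ m₃ - A m₁ m₂ * A m₀ m₃ + A m₁ m₃ * A m₀ m₂ ≠ 0 := by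
    rw [hskew m₀ m₁]; intro h; apply hp; linear_combination -h
  have hp2 : A m₂ m₀ * A m₁ m₃ - A m₂ m₁ * A m₀ m₃ + A m₂ m₃ * A m₀ m₁ ≠ 0 := by
    rw [hskew m₀ m₂, hskew m₁ m₂]; intro h; apply hp; linear_combination h
  have hp3 : A m₃ m₀ * A m₁ m₂ - A m₃ m₁ * A m₀ m₂ + A m₃ m₂ * A m₀ m₁ ≠ 0 := by
    rw [hskew m₀ m₃, hskew m₁ m₃, hskew m₂ m₃]; intro h; apply hp; linear_combination -h
  -- the four entries `A a' m_r` vanish for every `a'` outside `{m₀, …, m₃}`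
  have row : ∀ a', a' ≠ m₀ → a' ≠ m₁ → a' ≠ m₂ → a' ≠ m₃ →
      A a' m₀ = 0 ∧ A a' m₁ = 0 ∧ A a' m₂ = 0 ∧ A a' m₃ = 0 := by
    intro a' g₀ g₁ g₂ g₃
    refine ⟨?_, ?_, ?_, ?_⟩
    · exact entry_eq_zero_of_pfaffians A a' m₀ m₁ m₂ m₃ hp
        (hout _ _ _ _ ⟨m₁, e₁, g₁.symm, h01.symm, h12, h13⟩)
        (hout _ _ _ _ ⟨m₂, e₂, g₂.symm, h02.symm, h12.symm, h23⟩)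
        (hout _ _ _ _ ⟨m₃, e₃, g₃.symm, h03.symm, h13.symm, h23.symm⟩)
    · exact entry_eq_zero_of_pfaffians A a' m₁ m₀ m₂ m₃ hp1
        (hout _ _ _ _ ⟨m₀, e₀, g₀.symm, h01, h02, h03⟩)
        (hout _ _ _ _ ⟨m₂, e₂, g₂.symm, h12.symm, h02.symm, h23⟩)
        (hout _ _ _ _ ⟨m₃, e₃, g₃.symm, h13.symm, h03.symm, h23.symm⟩)
    · exact entry_eq_zero_of_pfaffians A a' m₂ m₀ m₁ m₃ hp2
        (hout _ _ _ _ ⟨m₀, e₀, g₀.symm, h02, h01, h03⟩)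
        (hout _ _ _ _ ⟨m₁, e₁, g₁.symm, h12, h01.symm, h13⟩)
        (hout _ _ _ _ ⟨m₃, e₃, g₃.symm, h23.symm, h03.symm, h13.symm⟩)
    · exact entry_eq_zero_of_pfaffians A a' m₃ m₀ m₁ m₂ hp3
        (hout _ _ _ _ ⟨m₀, e₀, g₀.symm, h03, h01, h02⟩)
        (hout _ _ _ _ ⟨m₁, e₁, g₁.symm, h13, h01.symm, h12⟩)
        (hout _ _ _ _ ⟨m₂, e₂, g₂.symm, h23, h02.symm, h12.symm⟩)
  obtain ⟨ra₀, ra₁, ra₂, ra₃⟩ := row a ha₀ ha₁ ha₂ ha₃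
  by_cases hb₀ : b = m₀
  · subst hb₀; exact ra₀
  by_cases hb₁ : b = m₁
  · subst hb₁; exact ra₁
  by_cases hb₂ : b = m₂
  · subst hb₂; exact ra₂
  by_cases hb₃ : b = m₃
  · subst hb₃; exact ra₃
  obtain ⟨rb₀, rb₁, rb₂, rb₃⟩ := row b hb₀ hb₁ hb₂ hb₃
  -- both indices outside: `A a b · A m_r m_s = Pf(a, b, m_r, m_s) = 0`, and some `A m_r m_s ≠ 0`
  by_contra hab
  have z : ∀ r s : n, A a r = 0 → A b s = 0 → A a s = 0 → A b r = 0 →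
      (∃ w ∈ [m₀, m₁, m₂, m₃], w ≠ a ∧ w ≠ b ∧ w ≠ r ∧ w ≠ s) → A r s = 0 := by
    intro r s har hbs has hbr hw
    have h := hout a b r s hw
    simp only [har, hbs, has, hbr, mul_zero, sub_zero, add_zero] at h
    exact (mul_eq_zero.mp h).resolve_left hab
  have z01 := z m₀ m₁ ra₀ rb₁ ra₁ rb₀ ⟨m₂, e₂, ha₂.symm, Ne.symm hb₂, h02.symm, h12.symm⟩
  have z23 := z m₂ m₃ ra₂ rb₃ ra₃ rb₂ ⟨m₀, e₀, ha₀.symm, Ne.symm hb₀, h02, h03⟩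
  have z02 := z m₀ m₂ ra₀ rb₂ ra₂ rb₀ ⟨m₁, e₁, ha₁.symm, Ne.symm hb₁, h01.symm, h12⟩
  have z13 := z m₁ m₃ ra₁ rb₃ ra₃ rb₁ ⟨m₀, e₀, ha₀.symm, Ne.symm hb₀, h01, h03⟩
  have z03 := z m₀ m₃ ra₀ rb₃ ra₃ rb₀ ⟨m₁, e₁, ha₁.symm, Ne.symm hb₁, h01.symm, h13⟩
  have z12 := z m₁ m₂ ra₁ rb₂ ra₂ rb₁ ⟨m₀, e₀, ha₀.symm, Ne.symm hb₀, h01, h02⟩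
  apply hp
  rw [z01, z23, z02, z13, z03, z12]; ring

end Support


end Summit.Ventures.HSemireg.EdgeDigitSupport
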